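import Literature.Geometry.Lorentzian.KerrSchildCoord
import HarnessLib

/-!
# The energy identity for the Kerr wave equation in Kerr–Schild coordinates: the conserved
# current of the Killing multiplier `∂_{t*}`

(family `gr`, infrastructure for **gr.S24**; trunk G08 = T-LORENTZ; namespace `Literature.Lorentz.Kerr`)

For a solution `ψ` of `□_g ψ = 0` on a chart domain `Kerr.region a r₀` of the Kerr metric in
ingoing Kerr–Schild coordinates, the energy current of the stationary Killing field `T = ∂_{t*}`
is `J^μ = T^μ{}_ν[ψ] T^ν = (g^{μν} ∂_νψ) ∂_0ψ − ½ δ^μ_0 g^{αβ} ∂_αψ ∂_βψ` (`Kerr.tCurrent`, for a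
representative `Φ` of `ψ`). This file proves, from the divergence form of `□_g`
(`Kerr.dalembertian_eq_divergence`, `det g = −1`) and stationarity (`∂_0 g^{μν} = 0`), the
**coordinate conservation law**

* `Kerr.sum_fderiv_tCurrent_eq`: `∑_μ ∂_μ J^μ = (□_g ψ) ∂_0Φ`, hence `= 0` for solutions
  (`Kerr.sum_fderiv_tCurrent_eq_zero`) — the identity `∇^μ (T_{μν} T^ν) = (□_g ψ)(Tψ)` for a
  Killing `T` (`∇^μ T_{μν} = (□_g ψ) ∂_νψ` and `K^T = T_{μν} ∇^μ T^ν = 0`; Dafermos–Rodnianski–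
  Shlapentokh-Rothman arXiv:1402.7034, §2.3.1–§2.3.2, where `𝓔^V = −(□_g Ψ) V^ν Ψ_{,ν}`),
  written in coordinates where `∇_μ J^μ = ∂_μ J^μ` (`det g = −1`);
* `Kerr.sum_tCurrent_mul_eq_stressEnergy`: `∑_μ J^μ n_μ = T[ψ](∂_{t*}, g♯n)` for every coordinate
  covector `n`, where `T[ψ] = g.stressEnergy ψ` is the abstract stress–energy tensor of
  `EnergyCurrents.lean` — so the dominant energy condition proved there
  (`LorentzianMetric.stressEnergy_nonneg_of_isTimelike`) controls the sign of the flux densities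
  `∑ J^μ n_μ` through hypersurfaces with timelike normal `g♯n`, wherever `∂_{t*}` is timelike
  (off the ergoregion, in particular in the far region used by `kerr_far_TEnergy_comparison`).

* `Kerr.fluxQuad`, `Kerr.fluxQuad_bounds`, `Kerr.abs_inverseMetric_sub_etaComp_le`,
  `Kerr.graphFluxDensity`, `Kerr.graphFluxDensity_bounds`: the flux density
  `f_F(τ, y) = −∑ J^μ n_μ` through a graph `{t* = τ + F(y)}` (`n = dt* − dF`) and its two-sided
  comparison `⅛ ∑(∂_μΦ)² ≤ f_F ≤ ∑(∂_μΦ)²` in the almost Minkowskian far region (`2H ≤ 1/72`,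
  `‖dF‖ ≤ 1/4`), i.e. `J^T_μ n^μ ∼ ∑(∂ψ)²` with explicit constants (DRSR §3.1, display after (23)).

* `E4.spaceEmbed`, `E4.hasFDerivAt_graphMap`, `Kerr.fderiv_comp_graphMap`,
  `Kerr.graphFluxDeriv`, `Kerr.hasDerivAt_graphFluxDensity`, `Kerr.graphFluxDeriv_eq`: calculus of
  the graph maps `y ↦ (τ + F(y), y)` and the differential divergence identity
  `∂_θ f_{F_θ} = ∑_i ∂_{y_i}[J^{i+1}∘P_θ · κ'G] − κ'G (∂_μJ^μ)∘P_θ` for a one-parameter family of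
  heights `F_θ = F₁ + κ(θ)G` (DRSR §2.3.2 in differential form).

These are the pointwise ingredients of the far-region `J^T` comparison
(`Literature.Geometry.Lorentzian.kerr_far_TEnergy_comparison`, `KerrWaveEnergy.lean`); the remaining step is the
integration of `∑_μ ∂_μ J^μ = 0` over the region between two graph hypersurfaces.

## References

* M. Dafermos, I. Rodnianski, Y. Shlapentokh-Rothman, arXiv:1402.7034, §2.2.2 (`T` Killing),
  §2.3.2 (divergence identity, `K^V`, `𝓔^V`) (key `DafermosRodnianskiShlapentokhrothman2014`).
* M. Dafermos, I. Rodnianski, *Lectures on black holes and linear waves*, arXiv:0811.0354,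
  App. D (`J^V_μ = T_{μν} V^ν`, `K^V`, `𝓔^V` and the divergence theorem) (key `DafermosRodnianski2008`).
* R. P. Kerr, A. Schild, 1965, §2 (`det g = −1`) (key `KerrSchild1965`).
* M. Visser, arXiv:0706.0622, (34) and §5 (key `arXiv07060622`).
-/

noncomputable section

open Set Filter
open scoped ContDiff Topology Manifold

namespace Literature.Geometry.Lorentzian.Kerr

/-! ### The energy current of the Killing multiplier `∂_{t*}` and its conservation -/

/-- The **energy current of the stationary Killing field `T = ∂_{t*}`** of a function `Φ` in
Kerr–Schild coordinates, with the first index raised: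
`J^μ = T^μ{}_0[Φ] = (∑_ν g^{μν} ∂_νΦ) ∂_0Φ − ½ δ^μ_0 g^{αβ} ∂_αΦ ∂_βΦ` (`J^V_μ = T_{μν} V^ν` with
`V = ∂_{t*}`; Dafermos–Rodnianski arXiv:0811.0354, App. D; DRSR arXiv:1402.7034, §2.3.1).
[cite: DafermosRodnianski2008, App. D] -/
def tCurrent (M a : ℝ) (Φ : E4 → ℝ) (x : E4) (μ : Fin 4) : ℝ :=
  (∑ ν, inverseMetric M a x μ ν * fderiv ℝ Φ x (E4.basisVector ν)) *
      fderiv ℝ Φ x (E4.basisVector 0) -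
    (if μ = 0 then 1 else 0) * (2⁻¹ * ∑ α, ∑ β, inverseMetric M a x α β *
      fderiv ℝ Φ x (E4.basisVector α) * fderiv ℝ Φ x (E4.basisVector β))

/-- **The coordinate divergence of the `∂_{t*}`-current is `(∑_μ ∂_μ(g^{μν}∂_νΦ)) ∂_0Φ`**:
the terms with second derivatives of `Φ` cancel by symmetry of `g^{μν}` and of `D²Φ`, and
`∂_0 g^{αβ} = 0` (stationarity, `Kerr.fderiv_inverseMetric_basisVector_zero`). Pure coordinate
identity on `{r > 0}` for `Φ` of class `C²` at `x`; it is the coordinate form of `K^T = 0` for the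
Killing field `T` (DRSR arXiv:1402.7034, §2.3.1: `K^V = T_{μν} ∇^μ V^ν`). [cite: DafermosRodnianskiShlapentokhrothman2014, §2.3.2] -/
theorem sum_fderiv_tCurrent (M a : ℝ) {x : E4} (hx : 0 < radius a x) {Φ : E4 → ℝ}
    (hΦ : ContDiffAt ℝ 2 Φ x) :
    ∑ μ, fderiv ℝ (fun y ↦ tCurrent M a Φ y μ) x (E4.basisVector μ) =
      (∑ μ, fderiv ℝ (fun y ↦ ∑ ν, inverseMetric M a y μ ν * fderiv ℝ Φ y (E4.basisVector ν)) x
        (E4.basisVector μ)) * fderiv ℝ Φ x (E4.basisVector 0) := by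
  -- abbreviations
  set gI : E4 → Fin 4 → Fin 4 → ℝ := fun y ↦ inverseMetric M a y with hgI
  set A : Fin 4 → E4 → ℝ := fun μ y ↦ ∑ ν, gI y μ ν * fderiv ℝ Φ y (E4.basisVector ν) with hA
  set B : E4 → ℝ := fun y ↦ fderiv ℝ Φ y (E4.basisVector 0) with hB
  set C : E4 → ℝ := fun y ↦ 2⁻¹ * ∑ α, ∑ β, gI y α β *
    fderiv ℝ Φ y (E4.basisVector α) * fderiv ℝ Φ y (E4.basisVector β) with hC
  have hΦ1 : DifferentiableAt ℝ Φ x := hΦ.differentiableAt (by norm_num)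
  have hΦ2 : DifferentiableAt ℝ (fderiv ℝ Φ) x :=
    (hΦ.fderiv_right (m := 1) le_rfl).differentiableAt one_ne_zero
  have hsymm : ∀ v w, fderiv ℝ (fderiv ℝ Φ) x v w = fderiv ℝ (fderiv ℝ Φ) x w v :=
    fun v w ↦ (hΦ.isSymmSndFDerivAt (by simp)).eq v w
  -- derivative data
  have hdΦ : ∀ κ, HasFDerivAt (fun y ↦ fderiv ℝ Φ y (E4.basisVector κ))
      ((fderiv ℝ (fderiv ℝ Φ) x).flip (E4.basisVector κ)) x := by
    intro κ
    have := hΦ2.hasFDerivAt.clm_apply (hasFDerivAt_const (E4.basisVector κ) x)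
    simpa using this
  have hdg : ∀ μ ν, HasFDerivAt (fun y ↦ gI y μ ν) (fderiv ℝ (fun y ↦ gI y μ ν) x) x :=
    fun μ ν ↦ ((contDiffAt_inverseMetric M a hx μ ν (n := 1)).differentiableAt
      one_ne_zero).hasFDerivAt
  have hdA : ∀ μ, HasFDerivAt (A μ) (∑ ν, (gI x μ ν • (fderiv ℝ (fderiv ℝ Φ) x).flip (E4.basisVector ν) +
      fderiv ℝ Φ x (E4.basisVector ν) • fderiv ℝ (fun y ↦ gI y μ ν) x)) x :=
    fun μ ↦ HasFDerivAt.fun_sum fun ν _ ↦ (hdg μ ν).mul (hdΦ ν)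
  have hdB : HasFDerivAt B ((fderiv ℝ (fderiv ℝ Φ) x).flip (E4.basisVector 0)) x := hdΦ 0
  have hdC : HasFDerivAt C ((2⁻¹ : ℝ) • ∑ α, ∑ β,
      ((gI x α β * fderiv ℝ Φ x (E4.basisVector α)) • (fderiv ℝ (fderiv ℝ Φ) x).flip (E4.basisVector β) +
        fderiv ℝ Φ x (E4.basisVector β) • (gI x α β • (fderiv ℝ (fderiv ℝ Φ) x).flip (E4.basisVector α) +
          fderiv ℝ Φ x (E4.basisVector α) • fderiv ℝ (fun y ↦ gI y α β) x))) x := by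
    have := HasFDerivAt.fun_sum (u := Finset.univ) fun α (_ : α ∈ Finset.univ) ↦
      HasFDerivAt.fun_sum (u := Finset.univ) fun β (_ : β ∈ Finset.univ) ↦
        ((hdg α β).mul (hdΦ α)).mul (hdΦ β)
    exact this.const_mul (2⁻¹ : ℝ)
  -- the current and its derivative, componentwise
  have hJ : ∀ μ, (fun y ↦ tCurrent M a Φ y μ) =
      A μ * B - fun y ↦ (if μ = 0 then 1 else 0) * C y := fun μ ↦ rfl
  have hdJ : ∀ μ, fderiv ℝ (fun y ↦ tCurrent M a Φ y μ) x (E4.basisVector μ) =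
      (∑ ν, (gI x μ ν * fderiv ℝ (fderiv ℝ Φ) x (E4.basisVector μ) (E4.basisVector ν) +
        fderiv ℝ Φ x (E4.basisVector ν) * fderiv ℝ (fun y ↦ gI y μ ν) x (E4.basisVector μ))) * B x +
      A μ x * fderiv ℝ (fderiv ℝ Φ) x (E4.basisVector μ) (E4.basisVector 0) -
      (if μ = 0 then 1 else 0) * (2⁻¹ * ∑ α, ∑ β,
        (gI x α β * fderiv ℝ Φ x (E4.basisVector α) * fderiv ℝ (fderiv ℝ Φ) x (E4.basisVector μ) (E4.basisVector β) +
          fderiv ℝ Φ x (E4.basisVector β) * (gI x α β * fderiv ℝ (fderiv ℝ Φ) x (E4.basisVector μ) (E4.basisVector α) +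
            fderiv ℝ Φ x (E4.basisVector α) * fderiv ℝ (fun y ↦ gI y α β) x (E4.basisVector μ)))) := by
    intro μ
    rw [hJ μ, (((hdA μ).mul hdB).sub (hdC.const_mul _)).fderiv]
    simp only [sub_apply, add_apply, smul_apply, sum_apply, smul_eq_mul,
      ContinuousLinearMap.flip_apply]
    ring
  -- the divergence of `A`, componentwise
  have hdivA : ∀ μ, fderiv ℝ (fun y ↦ ∑ ν, inverseMetric M a y μ ν *
      fderiv ℝ Φ y (E4.basisVector ν)) x (E4.basisVector μ) =
      ∑ ν, (gI x μ ν * fderiv ℝ (fderiv ℝ Φ) x (E4.basisVector μ) (E4.basisVector ν) +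
        fderiv ℝ Φ x (E4.basisVector ν) * fderiv ℝ (fun y ↦ gI y μ ν) x (E4.basisVector μ)) := by
    intro μ
    have : (fun y ↦ ∑ ν, inverseMetric M a y μ ν * fderiv ℝ Φ y (E4.basisVector ν)) = A μ := rfl
    rw [this, (hdA μ).fderiv]
    simp only [add_apply, smul_apply, sum_apply, smul_eq_mul, ContinuousLinearMap.flip_apply]
  simp only [hdJ, hdivA]
  -- stationarity kills `∂_0 g^{αβ}`
  have hstat : ∀ α β, fderiv ℝ (fun y ↦ gI y α β) x (E4.basisVector 0) = 0 :=
    fun α β ↦ fderiv_inverseMetric_basisVector_zero M a hx α β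
  -- reduce the sums over `μ` with the Kronecker delta
  rw [Finset.sum_sub_distrib, Finset.sum_add_distrib]
  have hδ : ∑ μ : Fin 4, (if μ = 0 then (1 : ℝ) else 0) * (2⁻¹ * ∑ α, ∑ β,
      (gI x α β * fderiv ℝ Φ x (E4.basisVector α) * fderiv ℝ (fderiv ℝ Φ) x (E4.basisVector μ) (E4.basisVector β) +
        fderiv ℝ Φ x (E4.basisVector β) * (gI x α β * fderiv ℝ (fderiv ℝ Φ) x (E4.basisVector μ) (E4.basisVector α) +
          fderiv ℝ Φ x (E4.basisVector α) * fderiv ℝ (fun y ↦ gI y α β) x (E4.basisVector μ)))) =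
      2⁻¹ * ∑ α, ∑ β, (gI x α β * fderiv ℝ Φ x (E4.basisVector α) * fderiv ℝ (fderiv ℝ Φ) x (E4.basisVector 0) (E4.basisVector β) +
        fderiv ℝ Φ x (E4.basisVector β) * (gI x α β * fderiv ℝ (fderiv ℝ Φ) x (E4.basisVector 0) (E4.basisVector α))) := by
    rw [Fin.sum_univ_four]
    simp only [if_true, Fin.isValue, if_false, zero_mul, add_zero,
      show (1 : Fin 4) ≠ 0 from by decide, show (2 : Fin 4) ≠ 0 from by decide,
      show (3 : Fin 4) ≠ 0 from by decide, hstat, mul_zero, one_mul]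
  rw [hδ, Finset.sum_mul]
  -- the two quadratic terms: Σ_μ A μ ∂_μ∂_0Φ = Σ_{αβ} gI αβ ∂_βΦ ∂_0∂_αΦ etc.
  have hAexp : ∑ μ, A μ x * fderiv ℝ (fderiv ℝ Φ) x (E4.basisVector μ) (E4.basisVector 0) =
      ∑ α, ∑ β, gI x α β * fderiv ℝ Φ x (E4.basisVector β) * fderiv ℝ (fderiv ℝ Φ) x (E4.basisVector 0) (E4.basisVector α) := by
    refine Finset.sum_congr rfl fun α _ ↦ ?_
    simp only [hA, Finset.sum_mul]
    exact Finset.sum_congr rfl fun β _ ↦ by rw [hsymm (E4.basisVector α) (E4.basisVector 0)]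
  have hsym2 : ∑ α, ∑ β, gI x α β * fderiv ℝ Φ x (E4.basisVector α) * fderiv ℝ (fderiv ℝ Φ) x (E4.basisVector 0) (E4.basisVector β) =
      ∑ α, ∑ β, gI x α β * fderiv ℝ Φ x (E4.basisVector β) * fderiv ℝ (fderiv ℝ Φ) x (E4.basisVector 0) (E4.basisVector α) := by
    rw [Finset.sum_comm]
    exact Finset.sum_congr rfl fun α _ ↦ Finset.sum_congr rfl fun β _ ↦ by
      simp only [hgI]; rw [inverseMetric_symm]
  rw [hAexp]
  have hC' : 2⁻¹ * ∑ α, ∑ β, (gI x α β * fderiv ℝ Φ x (E4.basisVector α) * fderiv ℝ (fderiv ℝ Φ) x (E4.basisVector 0) (E4.basisVector β) +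
      fderiv ℝ Φ x (E4.basisVector β) * (gI x α β * fderiv ℝ (fderiv ℝ Φ) x (E4.basisVector 0) (E4.basisVector α))) =
      ∑ α, ∑ β, gI x α β * fderiv ℝ Φ x (E4.basisVector β) * fderiv ℝ (fderiv ℝ Φ) x (E4.basisVector 0) (E4.basisVector α) := by
    have : ∀ α β, gI x α β * fderiv ℝ Φ x (E4.basisVector α) * fderiv ℝ (fderiv ℝ Φ) x (E4.basisVector 0) (E4.basisVector β) +
        fderiv ℝ Φ x (E4.basisVector β) * (gI x α β * fderiv ℝ (fderiv ℝ Φ) x (E4.basisVector 0) (E4.basisVector α)) =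
        gI x α β * fderiv ℝ Φ x (E4.basisVector α) * fderiv ℝ (fderiv ℝ Φ) x (E4.basisVector 0) (E4.basisVector β) +
          gI x α β * fderiv ℝ Φ x (E4.basisVector β) * fderiv ℝ (fderiv ℝ Φ) x (E4.basisVector 0) (E4.basisVector α) :=
      fun α β ↦ by ring
    simp only [this, Finset.sum_add_distrib, hsym2]
    ring
  rw [hC']
  simp only [hB]
  ring

/-- **Conservation of the `∂_{t*}`-energy current for the Kerr wave equation**: for
`ψ : Kerr.region a r₀ → ℝ` with representative `Φ` of class `C²` at `x`,
`∑_μ ∂_μ J^μ (x) = (□_g ψ)(x) ∂_0Φ(x)` — the identity `∇^μ (T_{μν} T^ν) = K^T − 𝓔^T` with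
`K^T = T_{μν}∇^μ T^ν = 0` (`T` Killing) and `𝓔^T = −(□_g ψ) Tψ` (DRSR arXiv:1402.7034, §2.3.1–
§2.3.2), in coordinates with `det g = −1` (`∇_μ J^μ = ∂_μ J^μ`, `Kerr.dalembertian_eq_divergence`). Here `□_g` is the prelude's
`PseudoRiemannianMetric.dalembertian` of `Kerr.smoothMetric M a r₀`, as in gr.S24.
[cite: DafermosRodnianskiShlapentokhrothman2014, §2.3.2] -/
theorem sum_fderiv_tCurrent_eq [Facts] [SliceFacts] (M a r₀ : ℝ) {ψ : region a r₀ → ℝ}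
    {Φ : E4 → ℝ} (hψ : ∀ y, ψ y = Φ y) (x : region a r₀) (hΦ : ContDiffAt ℝ 2 Φ x) :
    ∑ μ, fderiv ℝ (fun y ↦ tCurrent M a Φ y μ) x (E4.basisVector μ) =
      (smoothMetric M a r₀).toPseudoRiemannianMetric.dalembertian ψ x *
        fderiv ℝ Φ x (E4.basisVector 0) := by
  rw [sum_fderiv_tCurrent M a (radius_pos_of_mem_region x.2) hΦ,
    dalembertian_eq_divergence M a r₀ hψ x hΦ]

/-- For solutions of the wave equation the `∂_{t*}`-current is divergence-free in coordinates
(`∇^μ J^T_μ = 0`; DRSR arXiv:1402.7034, §2.3.2 with `V = T`). [cite: DafermosRodnianskiShlapentokhrothman2014, §2.3.2] -/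
theorem sum_fderiv_tCurrent_eq_zero [Facts] [SliceFacts] (M a r₀ : ℝ) {ψ : region a r₀ → ℝ}
    {Φ : E4 → ℝ} (hψ : ∀ y, ψ y = Φ y) (x : region a r₀) (hΦ : ContDiffAt ℝ 2 Φ x)
    (hsol : (smoothMetric M a r₀).toPseudoRiemannianMetric.dalembertian ψ x = 0) :
    ∑ μ, fderiv ℝ (fun y ↦ tCurrent M a Φ y μ) x (E4.basisVector μ) = 0 := by
  rw [sum_fderiv_tCurrent_eq M a r₀ hψ x hΦ, hsol, zero_mul]

/-- Components of `g♯` of a coordinate covector: `(g♯ n)^ν = ∑_μ g^{νμ} n_μ` (`Kerr.coSharp` in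
components). [cite: KerrSchild1965, §2] -/
theorem coSharp_covector_apply (M a : ℝ) (x : E4) (n : Fin 4 → ℝ) (ν : Fin 4) :
    coSharp M a x (E4.covector n : E4 →L[ℝ] ℝ) ν = ∑ μ, inverseMetric M a x ν μ * n μ := by
  simp only [inverseMetric_apply, sub_mul, Finset.sum_sub_distrib]
  have h1 : ∑ μ : Fin 4, (if ν = μ then (if ν = 0 then (-1 : ℝ) else 1) else 0) * n μ =
      (if ν = 0 then -1 else 1) * n ν := by
    fin_cases ν <;> simp
  have hp : ∀ μ, (E4.covector n : E4 →L[ℝ] ℝ) (E4.basisVector μ) = n μ := by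
    intro μ
    fin_cases μ <;> simp [E4.covector_apply, E4.basisVector]
  have hl : ((E4.covector n : E4 →L[ℝ] ℝ) : E4 →ₗ[ℝ] ℝ) (nullVector a x) =
      ∑ μ, nullVector a x μ * n μ := by
    rw [ContinuousLinearMap.coe_coe, E4.covector_apply]
    exact Finset.sum_congr rfl fun μ _ ↦ mul_comm _ _
  rw [h1]
  simp only [coSharp, etaSharp, ContinuousLinearMap.coe_coe] at hl ⊢
  rw [hl]
  have hν : (WithLp.toLp 2 fun μ ↦ if μ = 0 then -(E4.covector n) (E4.basisVector 0)
      else (E4.covector n) (E4.basisVector μ) : E4) ν = (if ν = 0 then -1 else 1) * n ν := by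
    by_cases h : ν = 0
    · subst h; simp [hp]
    · simp [h, hp]
  rw [WithLp.ofLp_sub, Pi.sub_apply, WithLp.ofLp_smul, Pi.smul_apply, smul_eq_mul, hν]
  congr 1
  rw [Finset.mul_sum, Finset.sum_mul]
  exact Finset.sum_congr rfl fun μ _ ↦ by ring

/-- The differential of a representative as a coordinate covector: `dΦ = ∑ (∂_μΦ) dx^μ`.
[folklore] -/
theorem fderiv_eq_covector (Φ : E4 → ℝ) (x : E4) :
    fderiv ℝ Φ x = E4.covector (fun μ ↦ fderiv ℝ Φ x (E4.basisVector μ)) := by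
  ext w
  rw [E4.covector_apply]
  conv_lhs => rw [eq_sum_basisVector w, map_sum]
  exact Finset.sum_congr rfl fun μ _ ↦ by rw [map_smul, smul_eq_mul, mul_comm]

/-- **The current is the abstract energy current of `EnergyCurrents.lean`**: for a coordinate
covector `n = ∑ n_μ dx^μ`, `∑_μ J^μ n_μ = T[ψ]_x (∂_{t*}, g♯ n)` where `T[ψ] = g.stressEnergy ψ x`
(`T[ψ](X, Y) = (Xψ)(Yψ) − ½ g(X, Y) g⁻¹(dψ, dψ)`) for `g = Kerr.smoothMetric M a r₀` and
`g♯ n = Kerr.coSharp M a x n`; i.e. `J^X_μ n^μ = T(X, n♯)` (Dafermos–Rodnianski arXiv:0811.0354,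
App. D). Hence the dominant energy condition proved in `EnergyCurrents.lean` governs the sign of
the flux densities built from `J`. [cite: DafermosRodnianski2008, App. D] -/
theorem sum_tCurrent_mul_eq_stressEnergy [Facts] (M a r₀ : ℝ) {ψ : region a r₀ → ℝ}
    {Φ : E4 → ℝ} (hψ : ∀ y, ψ y = Φ y) (x : region a r₀) (hΦ : DifferentiableAt ℝ Φ x)
    (n : Fin 4 → ℝ) :
    ∑ μ, tCurrent M a Φ x μ * n μ =
      (smoothMetric M a r₀).toPseudoRiemannianMetric.stressEnergy ψ x (E4.basisVector 0)
        (coSharp M a x (E4.covector n : E4 →L[ℝ] ℝ)) := by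
  have hx := radius_pos_of_mem_region x.2
  have hd : ∀ w : E4, mvfderiv 𝓘(ℝ, E4) ψ x w = fderiv ℝ Φ x w :=
    fun w ↦ OpensChart.mvfderiv_eq x ψ Φ hψ hΦ w
  -- components of `dΦ` and the expansion `dΦ(w) = ∑ w^μ p_μ`
  set p : Fin 4 → ℝ := fun μ ↦ fderiv ℝ Φ x (E4.basisVector μ) with hp
  have hPw : ∀ w : E4, fderiv ℝ Φ x w = ∑ μ, w μ * p μ := by
    intro w
    conv_lhs => rw [eq_sum_basisVector w, map_sum]
    exact Finset.sum_congr rfl fun μ _ ↦ by rw [map_smul, smul_eq_mul]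
  have hcov : ∀ w : E4, (E4.covector p : E4 →L[ℝ] ℝ) w = fderiv ℝ Φ x w := by
    intro w
    rw [E4.covector_apply, hPw]
    exact Finset.sum_congr rfl fun μ _ ↦ mul_comm _ _
  -- `♯dψ = g♯(∑ p_μ dx^μ)`
  have hsharp : (smoothMetric M a r₀).toPseudoRiemannianMetric.sharp x
      ((mvfderiv 𝓘(ℝ, E4) ψ x : TangentSpace 𝓘(ℝ, E4) x →L[ℝ] ℝ) :
        TangentSpace 𝓘(ℝ, E4) x →ₗ[ℝ] ℝ) = coSharp M a x (E4.covector p : E4 →L[ℝ] ℝ) :=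
    (smoothMetric M a r₀).sharp_eq_of_forall x _ _ fun w ↦ by
      show bilin M a x (coSharp M a x (E4.covector p : E4 →L[ℝ] ℝ)) w = mvfderiv 𝓘(ℝ, E4) ψ x w
      rw [bilin_coSharp M a hx, ContinuousLinearMap.coe_coe, hcov, hd w]
  -- expansion of `dΦ(g♯ m)` in coordinates
  have hexp : ∀ m : Fin 4 → ℝ, fderiv ℝ Φ x (coSharp M a x (E4.covector m : E4 →L[ℝ] ℝ)) =
      ∑ ν, ∑ μ, inverseMetric M a x ν μ * m μ * p ν := by
    intro m
    rw [hPw]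
    refine Finset.sum_congr rfl fun ν _ ↦ ?_
    rw [coSharp_covector_apply, Finset.sum_mul]
  -- the three `mvfderiv` values appearing in `T(∂₀, g♯n)`
  have h0 : mvfderiv 𝓘(ℝ, E4) ψ x (E4.basisVector 0) = p 0 := hd _
  have hn : mvfderiv 𝓘(ℝ, E4) ψ x (coSharp M a x (E4.covector n : E4 →L[ℝ] ℝ)) =
      ∑ ν, ∑ μ, inverseMetric M a x ν μ * n μ * p ν := (hd _).trans (hexp n)
  have hgrad : mvfderiv 𝓘(ℝ, E4) ψ x ((smoothMetric M a r₀).toPseudoRiemannianMetric.sharp x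
      ((mvfderiv 𝓘(ℝ, E4) ψ x : TangentSpace 𝓘(ℝ, E4) x →L[ℝ] ℝ) :
        TangentSpace 𝓘(ℝ, E4) x →ₗ[ℝ] ℝ)) = ∑ ν, ∑ μ, inverseMetric M a x ν μ * p μ * p ν :=
    ((congrArg (mvfderiv 𝓘(ℝ, E4) ψ x) hsharp).trans (hd _)).trans (hexp p)
  -- `g(∂₀, g♯n) = n₀`
  have hg0 : (smoothMetric M a r₀).toPseudoRiemannianMetric.val x (E4.basisVector 0)
      (coSharp M a x (E4.covector n : E4 →L[ℝ] ℝ)) = n 0 := by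
    show bilin M a x (E4.basisVector 0) (coSharp M a x (E4.covector n : E4 →L[ℝ] ℝ)) = n 0
    rw [bilin_symm, bilin_coSharp M a hx]
    simp [E4.covector_apply, E4.basisVector]
  rw [PseudoRiemannianMetric.stressEnergy_apply, PseudoRiemannianMetric.gradSq_eq, hgrad, hg0,
    h0, hn]
  -- the coordinate side
  simp only [tCurrent, sub_mul, Finset.sum_sub_distrib, Finset.sum_mul]
  have hδ : ∑ μ : Fin 4, (if μ = 0 then (1 : ℝ) else 0) * (2⁻¹ * ∑ α, ∑ β,
      inverseMetric M a x α β * fderiv ℝ Φ x (E4.basisVector α) *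
        fderiv ℝ Φ x (E4.basisVector β)) * n μ =
      2⁻¹ * (∑ α, ∑ β, inverseMetric M a x α β * fderiv ℝ Φ x (E4.basisVector α) *
        fderiv ℝ Φ x (E4.basisVector β)) * n 0 := by
    rw [Fin.sum_univ_four]
    simp
  rw [hδ]
  have h1 : ∑ μ, ∑ ν, inverseMetric M a x μ ν * fderiv ℝ Φ x (E4.basisVector ν) *
      fderiv ℝ Φ x (E4.basisVector 0) * n μ =
      p 0 * ∑ ν, ∑ μ, inverseMetric M a x ν μ * n μ * p ν := by
    rw [Finset.mul_sum, Finset.sum_comm]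
    refine Finset.sum_congr rfl fun ν _ ↦ ?_
    rw [Finset.mul_sum]
    refine Finset.sum_congr rfl fun μ _ ↦ ?_
    rw [inverseMetric_symm]
    simp only [hp]
    ring
  have h2 : ∑ α, ∑ β, inverseMetric M a x α β * fderiv ℝ Φ x (E4.basisVector α) *
      fderiv ℝ Φ x (E4.basisVector β) =
      ∑ ν, ∑ μ, inverseMetric M a x ν μ * p μ * p ν := by
    refine Finset.sum_congr rfl fun ν _ ↦ Finset.sum_congr rfl fun μ _ ↦ ?_
    simp only [hp]
    ring
  rw [h1, h2]
  ring

/-! ### Pointwise bounds for the flux density in the far (almost Minkowskian) region -/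

section Algebra

/-- `|∑_{μν} a_{μν} u_μ v_ν| ≤ A (∑|u_μ|)(∑|v_ν|)` when `|a_{μν}| ≤ A` (triangle inequality).
[folklore] -/
theorem abs_sum_sum_mul_mul_le {A : ℝ} (a : Fin 4 → Fin 4 → ℝ) (u v : Fin 4 → ℝ)
    (ha : ∀ μ ν, |a μ ν| ≤ A) :
    |∑ μ, ∑ ν, a μ ν * u μ * v ν| ≤ A * (∑ μ, |u μ|) * (∑ ν, |v ν|) := by
  calc |∑ μ, ∑ ν, a μ ν * u μ * v ν| ≤ ∑ μ, |∑ ν, a μ ν * u μ * v ν| :=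
        Finset.abs_sum_le_sum_abs _ _
    _ ≤ ∑ μ, ∑ ν, |a μ ν * u μ * v ν| :=
        Finset.sum_le_sum fun μ _ ↦ Finset.abs_sum_le_sum_abs _ _
    _ ≤ ∑ μ, ∑ ν, A * (|u μ| * |v ν|) := by
        refine Finset.sum_le_sum fun μ _ ↦ Finset.sum_le_sum fun ν _ ↦ ?_
        rw [abs_mul, abs_mul, mul_assoc]
        exact mul_le_mul_of_nonneg_right (ha μ ν) (mul_nonneg (abs_nonneg _) (abs_nonneg _))
    _ = A * (∑ μ, |u μ|) * (∑ ν, |v ν|) := by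
        rw [mul_assoc, Finset.sum_mul_sum, Finset.mul_sum]
        exact Finset.sum_congr rfl fun μ _ ↦ by rw [Finset.mul_sum]

/-- `(∑_{μ<4} |u_μ|)² ≤ 4 ∑ u_μ²` (Cauchy–Schwarz). [folklore] -/
theorem sq_sum_abs_le_four_mul (u : Fin 4 → ℝ) : (∑ μ, |u μ|) ^ 2 ≤ 4 * ∑ μ, u μ ^ 2 := by
  simp only [Fin.sum_univ_four]
  have h0 := sq_abs (u 0); have h1 := sq_abs (u 1); have h2 := sq_abs (u 2); have h3 := sq_abs (u 3)
  nlinarith [sq_nonneg (|u 0| - |u 1|), sq_nonneg (|u 0| - |u 2|), sq_nonneg (|u 0| - |u 3|),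
    sq_nonneg (|u 1| - |u 2|), sq_nonneg (|u 1| - |u 3|), sq_nonneg (|u 2| - |u 3|)]

/-- The `∂_0`-flux density of a covector `p` through a conormal `n`, for inverse-metric
components `g`: the quadratic form `−∑_μ J^μ n_μ` with `J^μ = (g^{μν}p_ν) p_0 − ½δ^μ_0 g^{αβ}p_αp_β`
(`Kerr.tCurrent` at the level of components; `J^T_μ n^μ`, DRSR arXiv:1402.7034, §2.3.2).
[cite: DafermosRodnianskiShlapentokhrothman2014, §2.3.2] -/
def fluxQuad (g : Fin 4 → Fin 4 → ℝ) (p n : Fin 4 → ℝ) : ℝ :=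
  -∑ μ, ((∑ ν, g μ ν * p ν) * p 0 -
    (if μ = 0 then 1 else 0) * (2⁻¹ * ∑ α, ∑ β, g α β * p α * p β)) * n μ

/-- `fluxQuad` is affine in `g`: `fluxQuad (g + h) = fluxQuad g + [−(∑ h n p) p₀ + ½ n₀ ∑ h p p]`.
[folklore] -/
theorem fluxQuad_add (g h : Fin 4 → Fin 4 → ℝ) (p n : Fin 4 → ℝ) :
    fluxQuad (fun μ ν ↦ g μ ν + h μ ν) p n = fluxQuad g p n +
      (-(∑ μ, ∑ ν, h μ ν * n μ * p ν) * p 0 +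
        n 0 * (2⁻¹ * ∑ α, ∑ β, h α β * p α * p β)) := by
  simp only [fluxQuad, Fin.sum_univ_four, Fin.isValue, if_true,
    show (1 : Fin 4) ≠ 0 from by decide, show (2 : Fin 4) ≠ 0 from by decide,
    show (3 : Fin 4) ≠ 0 from by decide, if_false]
  ring

/-- The Minkowski value: `fluxQuad η p n = ½(p₀² + |p⃗|²) − p₀ (n⃗·p⃗)` for `n₀ = 1` (the
`∂_t`-energy flux of the flat wave equation through a graph; e.g. Dafermos–Rodnianski
arXiv:0811.0354, App. D for `g = η`). [folklore] -/
theorem fluxQuad_etaComp (p n : Fin 4 → ℝ) (hn0 : n 0 = 1) :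
    fluxQuad etaComp p n =
      2⁻¹ * (p 0 ^ 2 + (p 1 ^ 2 + p 2 ^ 2 + p 3 ^ 2)) - p 0 * (n 1 * p 1 + n 2 * p 2 + n 3 * p 3) := by
  simp only [fluxQuad, etaComp, Fin.sum_univ_four, Fin.isValue, if_true,
    show (1 : Fin 4) ≠ 0 from by decide, show (2 : Fin 4) ≠ 0 from by decide,
    show (3 : Fin 4) ≠ 0 from by decide, show (0 : Fin 4) ≠ 1 from by decide,
    show (0 : Fin 4) ≠ 2 from by decide, show (0 : Fin 4) ≠ 3 from by decide,
    show (1 : Fin 4) ≠ 2 from by decide, show (1 : Fin 4) ≠ 3 from by decide,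
    show (2 : Fin 4) ≠ 1 from by decide, show (2 : Fin 4) ≠ 3 from by decide,
    show (3 : Fin 4) ≠ 1 from by decide, show (3 : Fin 4) ≠ 2 from by decide, if_false, hn0]
  ring

/-- Perturbation bound: `|−(∑ h n p) p₀ + ½ ∑ h p p| ≤ 8 ε ∑ p²` for `|h_{μν}| ≤ ε` and
`∑|n_μ| ≤ 5/2`. [folklore] -/
theorem fluxQuad_pert_bound (h : Fin 4 → Fin 4 → ℝ) (p n : Fin 4 → ℝ) {ε : ℝ} (hε0 : 0 ≤ ε)
    (hh : ∀ μ ν, |h μ ν| ≤ ε) (hn : ∑ μ, |n μ| ≤ 5 / 2) :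
    |-(∑ μ, ∑ ν, h μ ν * n μ * p ν) * p 0 + 2⁻¹ * ∑ α, ∑ β, h α β * p α * p β| ≤
      8 * ε * ∑ μ, p μ ^ 2 := by
  set S : ℝ := ∑ μ, p μ ^ 2 with hS
  have hS0 : 0 ≤ S := Finset.sum_nonneg fun μ _ ↦ sq_nonneg _
  have hsum_p : (∑ μ, |p μ|) ^ 2 ≤ 4 * S := sq_sum_abs_le_four_mul p
  have hsum_p0 : 0 ≤ ∑ μ, |p μ| := Finset.sum_nonneg fun μ _ ↦ abs_nonneg _
  have hsum_n0 : 0 ≤ ∑ μ, |n μ| := Finset.sum_nonneg fun μ _ ↦ abs_nonneg _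
  have hp0 : |p 0| ^ 2 ≤ S := by
    rw [sq_abs, hS, Fin.sum_univ_four]
    nlinarith [sq_nonneg (p 1), sq_nonneg (p 2), sq_nonneg (p 3)]
  have hR1 : |(∑ μ, ∑ ν, h μ ν * n μ * p ν) * p 0| ≤ 5 * ε * S := by
    rw [abs_mul]
    have h1 := abs_sum_sum_mul_mul_le h n p hh
    have h2 : |∑ μ, ∑ ν, h μ ν * n μ * p ν| ≤ (5 / 2) * ε * ∑ ν, |p ν| := by
      calc _ ≤ ε * (∑ μ, |n μ|) * (∑ ν, |p ν|) := h1
        _ ≤ ε * (5 / 2) * (∑ ν, |p ν|) := by gcongr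
        _ = (5 / 2) * ε * ∑ ν, |p ν| := by ring
    have h3 : (∑ ν, |p ν|) * |p 0| ≤ 2 * S := by
      nlinarith [sq_nonneg ((∑ ν, |p ν|) / 2 - |p 0|), abs_nonneg (p 0)]
    calc |∑ μ, ∑ ν, h μ ν * n μ * p ν| * |p 0| ≤ ((5 / 2) * ε * ∑ ν, |p ν|) * |p 0| :=
          mul_le_mul_of_nonneg_right h2 (abs_nonneg _)
      _ = (5 / 2) * ε * ((∑ ν, |p ν|) * |p 0|) := by ring
      _ ≤ (5 / 2) * ε * (2 * S) := mul_le_mul_of_nonneg_left h3 (by positivity)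
      _ = 5 * ε * S := by ring
  have hR2 : |2⁻¹ * ∑ α, ∑ β, h α β * p α * p β| ≤ 2 * ε * S := by
    rw [abs_mul, abs_of_pos (by norm_num : (0 : ℝ) < 2⁻¹)]
    have h1 := abs_sum_sum_mul_mul_le h p p hh
    calc 2⁻¹ * |∑ α, ∑ β, h α β * p α * p β| ≤ 2⁻¹ * (ε * (∑ μ, |p μ|) * (∑ ν, |p ν|)) :=
          mul_le_mul_of_nonneg_left h1 (by norm_num)
      _ = 2⁻¹ * ε * (∑ μ, |p μ|) ^ 2 := by ring
      _ ≤ 2⁻¹ * ε * (4 * S) := by gcongr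
      _ = 2 * ε * S := by ring
  calc |-(∑ μ, ∑ ν, h μ ν * n μ * p ν) * p 0 + 2⁻¹ * ∑ α, ∑ β, h α β * p α * p β|
      ≤ |-(∑ μ, ∑ ν, h μ ν * n μ * p ν) * p 0| + |2⁻¹ * ∑ α, ∑ β, h α β * p α * p β| :=
        abs_add_le _ _
    _ ≤ 5 * ε * S + 2 * ε * S := by rw [neg_mul, abs_neg]; exact add_le_add hR1 hR2
    _ ≤ 8 * ε * S := by nlinarith

/-- `|p₀ (n⃗·p⃗)| ≤ ¼ ∑ p²` when `|n⃗|² ≤ ¼` (Cauchy–Schwarz and `ab ≤ a²/4 + b²`). [folklore] -/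
theorem mink_cross_bound (p n : Fin 4 → ℝ) (hn : n 1 ^ 2 + n 2 ^ 2 + n 3 ^ 2 ≤ 1 / 4) :
    |p 0 * (n 1 * p 1 + n 2 * p 2 + n 3 * p 3)| ≤ (1 / 4) * ∑ μ, p μ ^ 2 := by
  rw [Fin.sum_univ_four]
  have hcs : (n 1 * p 1 + n 2 * p 2 + n 3 * p 3) ^ 2 ≤
      (n 1 ^ 2 + n 2 ^ 2 + n 3 ^ 2) * (p 1 ^ 2 + p 2 ^ 2 + p 3 ^ 2) := by
    nlinarith [sq_nonneg (n 1 * p 2 - n 2 * p 1), sq_nonneg (n 1 * p 3 - n 3 * p 1),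
      sq_nonneg (n 2 * p 3 - n 3 * p 2)]
  have hsp : 0 ≤ p 1 ^ 2 + p 2 ^ 2 + p 3 ^ 2 := by positivity
  have hs2 : (n 1 * p 1 + n 2 * p 2 + n 3 * p 3) ^ 2 ≤ (1 / 4) * (p 1 ^ 2 + p 2 ^ 2 + p 3 ^ 2) :=
    hcs.trans (mul_le_mul_of_nonneg_right hn hsp)
  rw [abs_le]
  constructor
  · nlinarith [sq_nonneg (p 0 / 2 + (n 1 * p 1 + n 2 * p 2 + n 3 * p 3)), sq_nonneg (p 0)]
  · nlinarith [sq_nonneg (p 0 / 2 - (n 1 * p 1 + n 2 * p 2 + n 3 * p 3)), sq_nonneg (p 0)]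

/-- `∑ |n_μ| ≤ 5/2` for `n = (1, n⃗)`, `|n⃗|² ≤ 1/4`. [folklore] -/
theorem sum_abs_conormal_le (n : Fin 4 → ℝ) (hn0 : n 0 = 1)
    (hn : n 1 ^ 2 + n 2 ^ 2 + n 3 ^ 2 ≤ 1 / 4) : ∑ μ, |n μ| ≤ 5 / 2 := by
  rw [Fin.sum_univ_four, hn0, abs_one]
  have h1 : |n 1| ≤ 1 / 2 := abs_le.mpr ⟨by nlinarith [sq_nonneg (n 2), sq_nonneg (n 3)],
    by nlinarith [sq_nonneg (n 2), sq_nonneg (n 3)]⟩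
  have h2 : |n 2| ≤ 1 / 2 := abs_le.mpr ⟨by nlinarith [sq_nonneg (n 1), sq_nonneg (n 3)],
    by nlinarith [sq_nonneg (n 1), sq_nonneg (n 3)]⟩
  have h3 : |n 3| ≤ 1 / 2 := abs_le.mpr ⟨by nlinarith [sq_nonneg (n 1), sq_nonneg (n 2)],
    by nlinarith [sq_nonneg (n 1), sq_nonneg (n 2)]⟩
  linarith

/-- **Pointwise two-sided bound for the `∂_{t*}`-flux density through a gently sloped graph in
an almost Minkowskian metric**: if `|g^{μν} − η^{μν}| ≤ ε ≤ 1/72` and `n = (1, n₁, n₂, n₃)` with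
`n₁² + n₂² + n₃² ≤ 1/4`, then `⅛ ∑ p_μ² ≤ fluxQuad g p n ≤ ∑ p_μ²` (Minkowski part in
`[¼, ¾]·∑p²`, perturbation `≤ 8ε ∑p² ≤ ∑p²/9`). This is the quantitative form, in the far
region, of the comparability `J^T_μ n^μ ∼ ∑(∂ψ)²` used in DRSR arXiv:1402.7034, §3.1 (display
after (23)). [folklore] -/
theorem fluxQuad_bounds (g : Fin 4 → Fin 4 → ℝ) (p n : Fin 4 → ℝ) {ε : ℝ} (hε0 : 0 ≤ ε)
    (hε : ε ≤ 1 / 72) (hg : ∀ μ ν, |g μ ν - etaComp μ ν| ≤ ε) (hn0 : n 0 = 1)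
    (hn : n 1 ^ 2 + n 2 ^ 2 + n 3 ^ 2 ≤ 1 / 4) :
    (1 / 8) * ∑ μ, p μ ^ 2 ≤ fluxQuad g p n ∧ fluxQuad g p n ≤ ∑ μ, p μ ^ 2 := by
  have hdec := fluxQuad_add etaComp (fun μ ν ↦ g μ ν - etaComp μ ν) p n
  have hg' : (fun μ ν ↦ etaComp μ ν + (g μ ν - etaComp μ ν)) = g := by
    funext μ ν; ring
  rw [hg'] at hdec
  rw [hdec, fluxQuad_etaComp p n hn0, hn0, one_mul]
  have hS0 : 0 ≤ ∑ μ, p μ ^ 2 := Finset.sum_nonneg fun μ _ ↦ sq_nonneg _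
  have hPS : p 0 ^ 2 + (p 1 ^ 2 + p 2 ^ 2 + p 3 ^ 2) = ∑ μ, p μ ^ 2 := by
    rw [Fin.sum_univ_four]; ring
  have hm := abs_le.mp (mink_cross_bound p n hn)
  have hpert := abs_le.mp (fluxQuad_pert_bound (fun μ ν ↦ g μ ν - etaComp μ ν) p n hε0 hg
    (sum_abs_conormal_le n hn0 hn))
  have hε8 : 8 * ε * ∑ μ, p μ ^ 2 ≤ (8 / 72) * ∑ μ, p μ ^ 2 := by nlinarith
  rw [hPS]
  constructor
  · linarith [hm.2, hpert.1]
  · linarith [hm.1, hpert.2]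

end Algebra

/-- `|(ℓ♯)^μ| ≤ 1` wherever `r > 0` (`ℓ₀ = 1`, `|ℓ⃗| = 1`; Visser arXiv:0706.0622, (34)).
[cite: arXiv07060622, (34)] -/
theorem abs_nullVector_le_one {a : ℝ} {x : E4} (hx : 0 < radius a x) (μ : Fin 4) :
    |nullVector a x μ| ≤ 1 := by
  have hs := sum_sq_nullCovectorFun hx
  rw [nullVector_apply]
  have key : ∀ t : ℝ, t ^ 2 ≤ 1 → |t| ≤ 1 := fun t ht ↦ abs_le_one_iff_mul_self_le_one.mpr (by nlinarith)
  fin_cases μ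
  · simp [nullCovectorFun]
  · simp only [Fin.mk_one, Fin.isValue, one_ne_zero, if_false, one_mul]
    exact key _ (by nlinarith [sq_nonneg (nullCovectorFun a x 2), sq_nonneg (nullCovectorFun a x 3)])
  · simp only [Fin.reduceFinMk, Fin.isValue, Fin.reduceEq, if_false, one_mul]
    exact key _ (by nlinarith [sq_nonneg (nullCovectorFun a x 1), sq_nonneg (nullCovectorFun a x 3)])
  · simp only [Fin.reduceFinMk, Fin.isValue, Fin.reduceEq, if_false, one_mul]
    exact key _ (by nlinarith [sq_nonneg (nullCovectorFun a x 1), sq_nonneg (nullCovectorFun a x 2)])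

/-- **The inverse Kerr metric is `2H`-close to Minkowski**: `|g^{μν} − η^{μν}| ≤ 2H` for
`M ≥ 0`, wherever `r > 0` (`g^{μν} − η^{μν} = −2H ℓ^μ ℓ^ν`, Visser arXiv:0706.0622, §5).
[cite: arXiv07060622, §5] -/
theorem abs_inverseMetric_sub_etaComp_le {M : ℝ} (hM : 0 ≤ M) (a : ℝ) {x : E4}
    (hx : 0 < radius a x) (μ ν : Fin 4) :
    |inverseMetric M a x μ ν - etaComp μ ν| ≤ 2 * scalarH M a x := by
  rw [inverseMetric_apply, etaComp]
  have h1 := abs_nullVector_le_one hx μ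
  have h2 := abs_nullVector_le_one hx ν
  have hH := scalarH_nonneg hM a x
  rw [show (if μ = ν then (if μ = 0 then (-1 : ℝ) else 1) else 0) -
      2 * scalarH M a x * nullVector a x ν * nullVector a x μ -
      (if μ = ν then (if μ = 0 then (-1 : ℝ) else 1) else 0) =
      -(2 * scalarH M a x * (nullVector a x ν * nullVector a x μ)) by ring, abs_neg, abs_mul,
    abs_of_nonneg (by positivity : (0 : ℝ) ≤ 2 * scalarH M a x), abs_mul]
  calc 2 * scalarH M a x * (|nullVector a x ν| * |nullVector a x μ|)
      ≤ 2 * scalarH M a x * (1 * 1) := by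
        apply mul_le_mul_of_nonneg_left _ (by positivity)
        exact mul_le_mul h2 h1 (abs_nonneg _) zero_le_one
    _ = 2 * scalarH M a x := by ring

/-- The coordinate flux density `−∑ J^μ n_μ` is `fluxQuad` of the components (definitional).
[folklore] -/
theorem neg_sum_tCurrent_mul (M a : ℝ) (Φ : E4 → ℝ) (x : E4) (n : Fin 4 → ℝ) :
    -∑ μ, tCurrent M a Φ x μ * n μ =
      fluxQuad (inverseMetric M a x) (fun μ ↦ fderiv ℝ Φ x (E4.basisVector μ)) n := rfl

/-! ### The flux density of the `∂_{t*}`-current through a graph hypersurface -/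

/-- The spatial partial derivative `∂_i F (y) = dF_y(e_i)` of a height function `F : E3 → ℝ`.
[folklore] -/
def partialE3 (F : E3 → ℝ) (y : E3) (i : Fin 3) : ℝ := fderiv ℝ F y (EuclideanSpace.single i 1)

/-- The conormal `n = dt* − dF` of the graph `{t* = τ + F(y)}` at the point over `y`, in
components `(1, −∂₁F, −∂₂F, −∂₃F)` (for `dF = 0` this is `dt*`, the conormal of the Kerr–Schild
leaves; DRSR arXiv:1402.7034, §3.3: `n_{Σ̃_τ}`). [folklore] -/
def graphConormal (F : E3 → ℝ) (y : E3) : Fin 4 → ℝ :=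
  Fin.cases 1 (fun i ↦ -partialE3 F y i)

/-- Time component of the graph conormal: `n₀ = 1`. [folklore] -/
@[simp] theorem graphConormal_zero (F : E3 → ℝ) (y : E3) : graphConormal F y 0 = 1 := rfl

/-- Spatial components of the graph conormal: `n_i = −∂_iF`. [folklore] -/
@[simp] theorem graphConormal_succ (F : E3 → ℝ) (y : E3) (i : Fin 3) :
    graphConormal F y i.succ = -partialE3 F y i := rfl

/-- `|∂_i F| ≤ ‖dF‖` (operator norm, `‖e_i‖ = 1`). [folklore] -/
theorem abs_partialE3_le (F : E3 → ℝ) (y : E3) (i : Fin 3) : |partialE3 F y i| ≤ ‖fderiv ℝ F y‖ := by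
  have h := (fderiv ℝ F y).le_opNorm (EuclideanSpace.single i (1 : ℝ))
  rw [PiLp.norm_single, norm_one, mul_one, Real.norm_eq_abs] at h
  exact h

/-- Slope `‖dF‖ ≤ 1/4` gives `n₁² + n₂² + n₃² ≤ 3/16 ≤ 1/4`. [folklore] -/
theorem graphConormal_sq_le (F : E3 → ℝ) (y : E3) (hF : ‖fderiv ℝ F y‖ ≤ 1 / 4) :
    graphConormal F y 1 ^ 2 + graphConormal F y 2 ^ 2 + graphConormal F y 3 ^ 2 ≤ 1 / 4 := by
  have h : ∀ i : Fin 3, (partialE3 F y i) ^ 2 ≤ (1 / 4) ^ 2 := by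
    intro i
    have := (abs_partialE3_le F y i).trans hF
    have h0 : 0 ≤ |partialE3 F y i| := abs_nonneg _
    rw [← sq_abs]
    exact pow_le_pow_left₀ h0 this 2
  have e1 : graphConormal F y 1 = -partialE3 F y 0 := rfl
  have e2 : graphConormal F y 2 = -partialE3 F y 1 := rfl
  have e3 : graphConormal F y 3 = -partialE3 F y 2 := rfl
  rw [e1, e2, e3, neg_sq, neg_sq, neg_sq]
  linarith [h 0, h 1, h 2]

/-- The **flux density of the `∂_{t*}`-current through the graph `{t* = τ + F(y)}`** over the
point `y`, w.r.t. Lebesgue `dy`: `f_F(τ, y) = −∑_μ J^μ(τ + F(y), y) n_μ(y)`, `n = dt* − dF`. In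
Kerr–Schild coordinates `det g = −1`, so `dVol_g = dt* dy` and `J^T_μ n^μ_{Σ̃} dσ = f_F dy`
exactly through `Σ̃ = {t* = τ + F}` (DRSR arXiv:1402.7034, §2.3.2, §3.3; the same bookkeeping as
`Kerr.leafFluxDensity` of `KerrHyperboloidalFlux.lean`, there for the multiplier `V`).
[cite: DafermosRodnianskiShlapentokhrothman2014, §2.3.2] -/
def graphFluxDensity (M a : ℝ) (F : E3 → ℝ) (Φ : E4 → ℝ) (τ : ℝ) (y : E3) : ℝ :=
  -∑ μ, tCurrent M a Φ (E4.ofTimeSpace (τ + F y) y) μ * graphConormal F y μ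

/-- **Two-sided comparison of the graph flux density with the coordinate energy density** in
the far (almost Minkowskian) region: at points with `r > 0` and `2H ≤ 1/72`, for `M ≥ 0` and
slopes `‖dF‖ ≤ 1/4`, `⅛ ∑_μ (∂_μΦ)² ≤ f_F(τ, y) ≤ ∑_μ (∂_μΦ)²`. This is the comparability
`J^T_μ n^μ ∼ ∑(∂ψ)²` of DRSR arXiv:1402.7034, §3.1 (display after (23)) with explicit constants,
where `T = ∂_{t*}` is timelike and the graph is uniformly spacelike. [folklore] -/
theorem graphFluxDensity_bounds {M : ℝ} (hM : 0 ≤ M) (a : ℝ) (F : E3 → ℝ) (Φ : E4 → ℝ) (τ : ℝ)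
    (y : E3) (hr : 0 < radius a (E4.ofTimeSpace (τ + F y) y))
    (hH : 2 * scalarH M a (E4.ofTimeSpace (τ + F y) y) ≤ 1 / 72) (hF : ‖fderiv ℝ F y‖ ≤ 1 / 4) :
    (1 / 8) * ∑ μ, (fderiv ℝ Φ (E4.ofTimeSpace (τ + F y) y) (E4.basisVector μ)) ^ 2 ≤
        graphFluxDensity M a F Φ τ y ∧
      graphFluxDensity M a F Φ τ y ≤
        ∑ μ, (fderiv ℝ Φ (E4.ofTimeSpace (τ + F y) y) (E4.basisVector μ)) ^ 2 := by
  unfold graphFluxDensity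
  rw [neg_sum_tCurrent_mul]
  exact fluxQuad_bounds _ _ _ (by linarith [scalarH_nonneg hM a (E4.ofTimeSpace (τ + F y) y)]) hH
    (fun μ ν ↦ abs_inverseMetric_sub_etaComp_le hM a hr μ ν) rfl (graphConormal_sq_le F y hF)

/-- For the representative `Φ = Function.extend Subtype.val ψ 0` the sum `∑_μ (∂_μΦ)²` is the
`coordEnergyDensity` of `WeightedNorms.lean` (definitional). [folklore] -/
theorem sum_sq_fderiv_extend_eq (U : TopologicalSpace.Opens E4) (ψ : U → ℝ) (x : E4) :
    ∑ μ, (fderiv ℝ (Function.extend Subtype.val ψ 0) x (E4.basisVector μ)) ^ 2 =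
      coordEnergyDensity U ψ x := rfl

/-! ### Calculus of the graph maps `y ↦ (τ + F(y), y)` and the `θ`-derivative of the flux density -/

end Kerr

namespace E4

/-- The linear embedding `y ↦ (0, y)` of `E3` in `E4` (the Kerr–Schild slice `{t* = 0}`) as a
continuous linear map. Dafermos–Rodnianski arXiv:0811.0354, §5.1. [folklore] -/
def spaceEmbed : E3 →L[ℝ] E4 :=
  LinearMap.toContinuousLinearMap
    { toFun := ofTimeSpace 0
      map_add' := fun y y' ↦ by
        ext i; refine Fin.cases ?_ (fun j ↦ ?_) i <;> simp
      map_smul' := fun c y ↦ by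
        ext i; refine Fin.cases ?_ (fun j ↦ ?_) i <;> simp }

/-- `spaceEmbed y = (0, y)`. [folklore] -/
@[simp] theorem spaceEmbed_apply (y : E3) : spaceEmbed y = ofTimeSpace 0 y := rfl

/-- Splitting `(t, y) = t ∂_{t*} + (0, y)` (the same statement as
`E4.ofTimeSpace_eq_smul_add` of `MinkowskiCauchy.lean`, which this file does not import, with
`spaceEmbed`). [folklore] -/
theorem ofTimeSpace_eq_smul_add' (t : ℝ) (y : E3) :
    ofTimeSpace t y = t • basisVector 0 + spaceEmbed y := by
  ext i
  refine Fin.cases ?_ (fun j ↦ ?_) i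
  · simp
  · simp [Fin.succ_ne_zero]

/-- The derivative of the graph map `y ↦ (τ + F(y), y)` is `v ↦ dF(v) ∂_{t*} + (0, v)`.
[folklore] -/
theorem hasFDerivAt_graphMap {F : E3 → ℝ} {F' : E3 →L[ℝ] ℝ} {y : E3} (hF : HasFDerivAt F F' y)
    (τ : ℝ) :
    HasFDerivAt (fun y ↦ ofTimeSpace (τ + F y) y) (F'.smulRight (basisVector 0) + spaceEmbed) y := by
  have h : (fun y ↦ ofTimeSpace (τ + F y) y) = fun y ↦ (τ + F y) • basisVector 0 + spaceEmbed y :=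
    funext fun y ↦ ofTimeSpace_eq_smul_add' _ _
  rw [h]
  exact ((hF.const_add τ).smul_const (basisVector 0)).add spaceEmbed.hasFDerivAt

/-- The derivative of the graph map in the height parameter, `θ ↦ (τ + F₁(y) + κ(θ) G(y), y)`, is
`κ'(θ) G(y) ∂_{t*}`. [folklore] -/
theorem hasDerivAt_graphMap_param (F₁ G : E3 → ℝ) {κ : ℝ → ℝ} {κ' : ℝ} {θ : ℝ}
    (hκ : HasDerivAt κ κ' θ) (τ : ℝ) (y : E3) :
    HasDerivAt (fun θ ↦ ofTimeSpace (τ + (F₁ y + κ θ * G y)) y) ((κ' * G y) • basisVector 0) θ := by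
  have h : (fun θ ↦ ofTimeSpace (τ + (F₁ y + κ θ * G y)) y) =
      fun θ ↦ (τ + F₁ y + κ θ * G y) • basisVector 0 + spaceEmbed y :=
    funext fun θ ↦ by rw [ofTimeSpace_eq_smul_add', add_assoc]
  rw [h]
  have := (((hκ.mul_const (G y)).const_add (τ + F₁ y)).smul_const (basisVector 0)).add_const
    (spaceEmbed y)
  simpa using this

end E4

namespace Kerr

/-- Chain rule in the height parameter: `∂_θ [J(P_θ y)] = κ'(θ) G(y) ∂₀J (P_θ y)` for a function
`J` differentiable at the graph point `P_θ(y) = (τ + F₁(y) + κ(θ)G(y), y)`. [folklore] -/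
theorem hasDerivAt_comp_graphMap_param {J : E4 → ℝ} (F₁ G : E3 → ℝ) {κ : ℝ → ℝ} {κ' : ℝ} {θ : ℝ}
    (hκ : HasDerivAt κ κ' θ) (τ : ℝ) (y : E3)
    (hJ : DifferentiableAt ℝ J (E4.ofTimeSpace (τ + (F₁ y + κ θ * G y)) y)) :
    HasDerivAt (fun θ ↦ J (E4.ofTimeSpace (τ + (F₁ y + κ θ * G y)) y))
      (κ' * G y * fderiv ℝ J (E4.ofTimeSpace (τ + (F₁ y + κ θ * G y)) y) (E4.basisVector 0)) θ := by
  have h : HasDerivAt (fun θ ↦ J (E4.ofTimeSpace (τ + (F₁ y + κ θ * G y)) y))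
      (fderiv ℝ J (E4.ofTimeSpace (τ + (F₁ y + κ θ * G y)) y) ((κ' * G y) • E4.basisVector 0)) θ :=
    hJ.hasFDerivAt.comp_hasDerivAt (f := fun θ ↦ E4.ofTimeSpace (τ + (F₁ y + κ θ * G y)) y) θ
      (E4.hasDerivAt_graphMap_param F₁ G hκ τ y)
  refine h.congr_deriv ?_
  rw [map_smul, smul_eq_mul]

/-- Chain rule along the graph: `∂_{y_i} [J(P(y))] = ∂_iF(y) ∂₀J(P y) + ∂_{i+1} J (P y)` for
`P(y) = (τ + F(y), y)`. [folklore] -/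
theorem fderiv_comp_graphMap {J : E4 → ℝ} {F : E3 → ℝ} {y : E3} (hF : DifferentiableAt ℝ F y)
    (τ : ℝ) (hJ : DifferentiableAt ℝ J (E4.ofTimeSpace (τ + F y) y)) (i : Fin 3) :
    fderiv ℝ (fun y ↦ J (E4.ofTimeSpace (τ + F y) y)) y (EuclideanSpace.single i 1) =
      partialE3 F y i * fderiv ℝ J (E4.ofTimeSpace (τ + F y) y) (E4.basisVector 0) +
        fderiv ℝ J (E4.ofTimeSpace (τ + F y) y) (E4.basisVector i.succ) := by
  have h : HasFDerivAt (fun y ↦ J (E4.ofTimeSpace (τ + F y) y))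
      ((fderiv ℝ J (E4.ofTimeSpace (τ + F y) y)).comp
        ((fderiv ℝ F y).smulRight (E4.basisVector 0) + E4.spaceEmbed)) y :=
    hJ.hasFDerivAt.comp (f := fun y ↦ E4.ofTimeSpace (τ + F y) y) y
      (E4.hasFDerivAt_graphMap hF.hasFDerivAt τ)
  rw [h.fderiv]
  simp only [ContinuousLinearMap.coe_comp, Function.comp_apply, add_apply,
    ContinuousLinearMap.smulRight_apply, E4.spaceEmbed_apply, map_add, map_smul, smul_eq_mul,
    partialE3]
  congr 1
  congr 1
  ext j
  refine Fin.cases ?_ (fun k ↦ ?_) j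
  · simp [E4.basisVector, Fin.succ_ne_zero]
  · simp [E4.basisVector, Fin.succ_inj]

/-- Product rule for `V w` in a coordinate direction of `E3`. [folklore] -/
theorem fderiv_mul_comp_graphMap {V w : E3 → ℝ} {y : E3} (hV : DifferentiableAt ℝ V y)
    (hw : DifferentiableAt ℝ w y) (i : Fin 3) :
    fderiv ℝ (fun y ↦ V y * w y) y (EuclideanSpace.single i 1) =
      fderiv ℝ V y (EuclideanSpace.single i 1) * w y + V y * fderiv ℝ w y (EuclideanSpace.single i 1) := by
  rw [fderiv_fun_mul hV hw]
  simp only [add_apply, smul_apply, smul_eq_mul]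
  ring

/-- Partial derivatives of the interpolated height `F₁ + c G`. [folklore] -/
theorem partialE3_add_const_mul {F₁ G : E3 → ℝ} {y : E3} (hF₁ : DifferentiableAt ℝ F₁ y)
    (hG : DifferentiableAt ℝ G y) (c : ℝ) (i : Fin 3) :
    partialE3 (fun y ↦ F₁ y + c * G y) y i = partialE3 F₁ y i + c * partialE3 G y i := by
  simp only [partialE3]
  rw [fderiv_fun_add hF₁ (hG.const_mul c), fderiv_const_mul hG]
  simp only [add_apply, smul_apply, smul_eq_mul]

/-- `n₁ = −∂₁F`. [folklore] -/
@[simp] theorem graphConormal_one (F : E3 → ℝ) (y : E3) : graphConormal F y 1 = -partialE3 F y 0 := rfl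
/-- `n₂ = −∂₂F`. [folklore] -/
@[simp] theorem graphConormal_two (F : E3 → ℝ) (y : E3) : graphConormal F y 2 = -partialE3 F y 1 := rfl
/-- `n₃ = −∂₃F`. [folklore] -/
@[simp] theorem graphConormal_three (F : E3 → ℝ) (y : E3) : graphConormal F y 3 = -partialE3 F y 2 := rfl

/-- **Explicit formula for the `θ`-derivative of the graph flux density** along the family of
heights `F₁ + c G` (value `c`, rate `k = dc/dθ`):
`D(c, k, y) = −k G ∂₀J⁰(P) + ∑_i [k G ∂₀J^{i+1}(P) (∂_iF₁ + c ∂_iG) + J^{i+1}(P) k ∂_iG]`,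
`P = (τ + F₁(y) + c G(y), y)`. [folklore] -/
def graphFluxDeriv (M a : ℝ) (Φ : E4 → ℝ) (F₁ G : E3 → ℝ) (τ c k : ℝ) (y : E3) : ℝ :=
  -(k * G y * fderiv ℝ (fun x ↦ tCurrent M a Φ x 0) (E4.ofTimeSpace (τ + (F₁ y + c * G y)) y)
      (E4.basisVector 0)) +
    ∑ i : Fin 3, (k * G y * fderiv ℝ (fun x ↦ tCurrent M a Φ x i.succ)
        (E4.ofTimeSpace (τ + (F₁ y + c * G y)) y) (E4.basisVector 0) *
          (partialE3 F₁ y i + c * partialE3 G y i) +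
      tCurrent M a Φ (E4.ofTimeSpace (τ + (F₁ y + c * G y)) y) i.succ * (k * partialE3 G y i))

/-- **The flux density through the graphs of `F₁ + κ(θ) G` is differentiable in `θ`** with
derivative `graphFluxDeriv … (κ θ) (κ' θ) y`, provided `F₁, G` are differentiable at `y` and the
current is differentiable at the graph point (chain rules above). [folklore] -/
theorem hasDerivAt_graphFluxDensity (M a : ℝ) (Φ : E4 → ℝ) (F₁ G : E3 → ℝ) {κ : ℝ → ℝ} {κ' : ℝ}
    {θ : ℝ} (hκ : HasDerivAt κ κ' θ) (τ : ℝ) (y : E3)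
    (hF₁ : DifferentiableAt ℝ F₁ y) (hG : DifferentiableAt ℝ G y)
    (hJ : ∀ ν, DifferentiableAt ℝ (fun x ↦ tCurrent M a Φ x ν)
      (E4.ofTimeSpace (τ + (F₁ y + κ θ * G y)) y)) :
    HasDerivAt (fun ϑ ↦ graphFluxDensity M a (fun y ↦ F₁ y + κ ϑ * G y) Φ τ y)
      (graphFluxDeriv M a Φ F₁ G τ (κ θ) κ' y) θ := by
  set A : Fin 4 → ℝ → ℝ := fun μ ϑ ↦ tCurrent M a Φ (E4.ofTimeSpace (τ + (F₁ y + κ ϑ * G y)) y) μ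
    with hA
  set L : Fin 3 → ℝ → ℝ := fun i ϑ ↦ partialE3 F₁ y i + κ ϑ * partialE3 G y i with hL
  have hf : (fun ϑ ↦ graphFluxDensity M a (fun y ↦ F₁ y + κ ϑ * G y) Φ τ y) =
      -(A 0) + ∑ i : Fin 3, A i.succ * L i := by
    funext ϑ
    simp only [graphFluxDensity, Fin.sum_univ_four, Fin.sum_univ_three, graphConormal_zero,
      graphConormal_one, graphConormal_two, graphConormal_three, mul_one,
      partialE3_add_const_mul hF₁ hG, Pi.add_apply, Pi.neg_apply, Pi.mul_apply,
      hA, hL, Fin.succ_zero_eq_one, Fin.succ_one_eq_two, show (2 : Fin 3).succ = (3 : Fin 4) from rfl]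
    ring
  rw [hf]
  have hdA : ∀ μ, HasDerivAt (A μ) (κ' * G y *
      fderiv ℝ (fun x ↦ tCurrent M a Φ x μ) (E4.ofTimeSpace (τ + (F₁ y + κ θ * G y)) y)
        (E4.basisVector 0)) θ := fun μ ↦
    hasDerivAt_comp_graphMap_param (J := fun x ↦ tCurrent M a Φ x μ) F₁ G hκ τ y (hJ μ)
  have hdL : ∀ i, HasDerivAt (L i) (κ' * partialE3 G y i) θ := fun i ↦ by
    have := (hκ.mul_const (partialE3 G y i)).const_add (partialE3 F₁ y i)
    simpa [hL] using this
  have hder := (hdA 0).neg.add (HasDerivAt.sum fun i (_ : i ∈ Finset.univ) ↦ (hdA i.succ).mul (hdL i))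
  refine hder.congr_deriv ?_
  simp only [graphFluxDeriv, hA, hL]

/-- **The `θ`-derivative of the graph flux density is a spatial divergence minus `w · div J`**
(`w = k G`): `D(c, k, y) = ∑_i ∂_{y_i}[J^{i+1}(P(·)) w](y) − w(y) (∑_μ ∂_μ J^μ)(P(y))`,
`P(y) = (τ + F₁(y) + cG(y), y)`. This is the differential form of the divergence identity between
the graph hypersurfaces `{t* = τ + F₁ + cG}` (DRSR arXiv:1402.7034, §2.3.2): integrated in `y`
over the far region, the first term vanishes (divergence of a compactly supported field) and the
second vanishes for solutions (`∑_μ ∂_μ J^μ = 0`, `Kerr.sum_fderiv_tCurrent_eq_zero`), so the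
`∂_{t*}`-flux through `{t* = τ + F₁ + cG}` is independent of `c`.
[cite: DafermosRodnianskiShlapentokhrothman2014, §2.3.2] -/
theorem graphFluxDeriv_eq (M a : ℝ) (Φ : E4 → ℝ) (F₁ G : E3 → ℝ) (τ c k : ℝ) (y : E3)
    (hF₁ : DifferentiableAt ℝ F₁ y) (hG : DifferentiableAt ℝ G y)
    (hJ : ∀ ν, DifferentiableAt ℝ (fun x ↦ tCurrent M a Φ x ν)
      (E4.ofTimeSpace (τ + (F₁ y + c * G y)) y)) :
    graphFluxDeriv M a Φ F₁ G τ c k y =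
      (∑ i : Fin 3, fderiv ℝ (fun y ↦ tCurrent M a Φ (E4.ofTimeSpace (τ + (F₁ y + c * G y)) y)
          i.succ * (k * G y)) y (EuclideanSpace.single i 1)) -
        k * G y * ∑ μ, fderiv ℝ (fun x ↦ tCurrent M a Φ x μ)
          (E4.ofTimeSpace (τ + (F₁ y + c * G y)) y) (E4.basisVector μ) := by
  have hFc : DifferentiableAt ℝ (fun y ↦ F₁ y + c * G y) y := hF₁.add (hG.const_mul _)
  have hcomp : ∀ ν, DifferentiableAt ℝ
      (fun y ↦ tCurrent M a Φ (E4.ofTimeSpace (τ + (F₁ y + c * G y)) y) ν) y := fun ν ↦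
    ((hJ ν).hasFDerivAt.comp (f := fun y ↦ E4.ofTimeSpace (τ + (F₁ y + c * G y)) y) y
      (E4.hasFDerivAt_graphMap hFc.hasFDerivAt τ)).differentiableAt
  have hw : DifferentiableAt ℝ (fun y ↦ k * G y) y := hG.const_mul _
  have hdiv : ∀ i : Fin 3, fderiv ℝ (fun y ↦ tCurrent M a Φ
      (E4.ofTimeSpace (τ + (F₁ y + c * G y)) y) i.succ * (k * G y)) y (EuclideanSpace.single i 1) =
      (partialE3 (fun y ↦ F₁ y + c * G y) y i *
          fderiv ℝ (fun x ↦ tCurrent M a Φ x i.succ) (E4.ofTimeSpace (τ + (F₁ y + c * G y)) y)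
            (E4.basisVector 0) +
        fderiv ℝ (fun x ↦ tCurrent M a Φ x i.succ) (E4.ofTimeSpace (τ + (F₁ y + c * G y)) y)
          (E4.basisVector i.succ)) * (k * G y) +
        tCurrent M a Φ (E4.ofTimeSpace (τ + (F₁ y + c * G y)) y) i.succ *
          (k * partialE3 G y i) := by
    intro i
    rw [fderiv_mul_comp_graphMap (hcomp i.succ) hw,
      fderiv_comp_graphMap (J := fun x ↦ tCurrent M a Φ x i.succ) hFc τ (hJ i.succ)]
    simp only [partialE3, fderiv_const_mul hG, smul_apply, smul_eq_mul]
  simp only [hdiv, graphFluxDeriv, partialE3_add_const_mul hF₁ hG, Fin.sum_univ_four,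
    Fin.sum_univ_three, Fin.succ_zero_eq_one, Fin.succ_one_eq_two,
    show (2 : Fin 3).succ = (3 : Fin 4) from rfl]
  ring

end Literature.Geometry.Lorentzian.Kerr

end
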